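import Summits.Ventures.CertifiedManyBodySolver.Downfold.EmeryShapeWindowClosure
import Summits.Ventures.CertifiedManyBodySolver.Downfold.EmeryFermiScalePointsTl1223OPK11VirtualCorners
import HarnessLib

/-!
# THE ONE-BAND FERMI-SURFACE SHAPE `t′/t` OF THE WHOLE TYPED 3BE BOX `emeryBoxTl1223OPK11Src (EmeryBoxesKSlicesO)` FROM TWO VIRTUAL CORNERS (two-ray rule + window closure, §B.86;
# router/EMERY-SHAPE-CORNERS.tsv)

Venture CertifiedManyBodySolver, cell `pub/hubbard-downfold` (stage S1; INFLATION-RULES-3to1-B §B.86 (i)), seat hubbard-downfold-mod-4 (technique B, g35); namespace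
`Summit.Ventures.CertifiedManyBodySolver.Downfold.Emery`. Everything PROVED (0 sorry). WHAT THIS IS NOT: a statement about TlBa₂Ca₂Cu₃O₉ OUTER plane ((K) source box) — the typed box is SCREENING-GRADE (its file's
grade line); `U = 0` one-body kinematics of the σ model (object E = the EXACT `t–t′` shape of the σ Fermi surface, `EmeryFermiSurfaceShape`); no interaction, no `t″`.

For EVERY one-body row `(Δ, t_pd, t_pp, t_pp′) ∈ [147/100, 56/25] × [117/100, 69/50] × [61/100, 73/100] × [7/50, 9/50]` eV and the fillings below, the one-band `t′/t` of the σ-model Fermi surface AT THAT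
ROW'S OWN FERMI ENERGY lies in the window of the table (device: `EmeryShapeTwoRayRule` + `EmeryShapeWindowClosure`, exactly as `EmeryBoxesLa214ShapeCorners`; virtual corners
`V_lo = (1.47, 1.17, 0.73, 0.2154)`, `V_hi = (2.24, 1.38, 0.61, 0.117)`, t_pp′ outside the typed range by the factor b₂/b₁ = 1.197 — the explicit 3 → 1 inflation, zero iff the box is pure or of fixed
t_pp′/t_pp ratio; certificates `EmeryFermiScalePointsTl1223OPK11VirtualCorners`).

| filling | certified window for t′/t over the WHOLE box | V_lo ε_F bracket | V_hi ε_F bracket | lower closure | EMERY-FS-WINDOWS (g19 sub-box device) | object-E row of record [float] |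
|---|---|---|---|---|---|---|
| n_H = 1.14 (ν = 43/100) | **[-0.3413, -0.2498]** | [1.6155, 1.6305] eV | [1.7796, 1.7896] eV | antitone (dd ≥ 0.330 on the window): L = fsRatio(V_lo; e₂) | [-0.3346,-0.2531] (n_H band) | [-0.486,-0.373] |
| n_H = 1.18 (ν = 41/100) | **[-0.3411, -0.2501]** | [1.5702, 1.5852] eV | [1.7431, 1.7531] eV | antitone (dd ≥ 0.265 on the window): L = fsRatio(V_lo; e₂) | [-0.3346,-0.2531] (n_H band) | [-0.486,-0.373] |

Sources: three-band model [HybertsenSchluterChristensen1989, Eq. (1)]; [AndersenEtAl1995, §6]; box rows as cited in the typed object's file.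
-/

noncomputable section

namespace Summit.Ventures.CertifiedManyBodySolver.Downfold.Emery

open Real Set

/-- **n_H = 1.14 (ν = 43/100): for every row of the box the one-band Fermi-surface `t′/t` (object E, at the row's own Fermi energy) lies in `[-0.3413, -0.2498]`.** Lower closure: antitone; upper: monotone. [folklore] -/
theorem tl1223OPK11Box_fsRatio_nH114 {Δ a b c : ℝ} (hΔ : Δ ∈ Icc ((147 : ℝ) / 100) ((56 : ℝ) / 25)) (ha : a ∈ Icc ((117 : ℝ) / 100) ((69 : ℝ) / 50)) (hb : b ∈ Icc ((61 : ℝ) / 100) ((73 : ℝ) / 100)) (hc : c ∈ Icc ((7 : ℝ) / 50) ((9 : ℝ) / 50)) :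
    fsRatio Δ a b c (fermiEnergyOf Δ a b c ((43 : ℝ) / 100)) ∈ Icc ((-3413 : ℝ) / 10000) ((-1249 : ℝ) / 5000) := by
  have hV : ((9 : ℝ) / 50) * ((73 : ℝ) / 100) / ((61 : ℝ) / 100) = ((657 : ℝ) / 3050) := by norm_num
  have hW : ((7 : ℝ) / 50) * ((61 : ℝ) / 100) / ((73 : ℝ) / 100) = ((427 : ℝ) / 3650) := by norm_num
  have hVlo := (fermiEnergyOf_of_pointBracketCheck virtPt_Tl1223OPK11Vlo_nH114_br (by norm_num) (by norm_num) (by norm_num) (ν := (43/100 : ℝ)) (by push_cast; exact ⟨le_rfl, le_rfl⟩)).2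
  have hVhi := (fermiEnergyOf_of_pointBracketCheck virtPt_Tl1223OPK11Vhi_nH114_br (by norm_num) (by norm_num) (by norm_num) (ν := (43/100 : ℝ)) (by push_cast; exact ⟨le_rfl, le_rfl⟩)).2
  have hAlo := (fermiEnergyOf_of_pointBracketCheck virtPt_Tl1223OPK11Alo_nH114_br (by norm_num) (by norm_num) (by norm_num) (ν := (43/100 : ℝ)) (by push_cast; exact ⟨le_rfl, le_rfl⟩)).2
  have hTop := (fermiEnergyOf_of_pointBracketCheck virtPt_Tl1223OPK11H_nH114_br (by norm_num) (by norm_num) (by norm_num) (ν := (43/100 : ℝ)) (by push_cast; exact ⟨le_rfl, le_rfl⟩)).2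
  push_cast at hVlo hVhi hAlo hTop
  norm_num at hVlo hVhi hAlo hTop
  refine fsRatio_fermiEnergyOf_mem_Icc_windowClosure (Δ₁ := ((147 : ℝ) / 100)) (Δ₂ := ((56 : ℝ) / 25)) (a₁ := ((117 : ℝ) / 100)) (a₂ := ((69 : ℝ) / 50)) (b₁ := ((61 : ℝ) / 100))
    (b₂ := ((73 : ℝ) / 100)) (c₁ := ((7 : ℝ) / 50)) (c₂ := ((9 : ℝ) / 50)) (e₁ := ((3231 : ℝ) / 2000)) (e₂ := ((16977 : ℝ) / 10000)) (e₃ := 0) (e₄ := ((2237 : ℝ) / 1250)) (by norm_num) (by norm_num) (by norm_num) (by norm_num)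
    (by norm_num) hΔ ha hb hc (by norm_num) (by norm_num) ?_ ?_ ?_ (by norm_num) ?_ ?_ ?_ (by norm_num) ?_
  · -- regime at the box's Fermi-energy high corner: c₂ b₂ ε_F(Δ₁, a₂, b₂, c₁) ≤ a₁² b₁
    nlinarith [hTop.2]
  · rw [hV]; exact hVlo.1
  · exact hAlo.2
  · intro ε hε
    rw [hV]
    have hanti := (fsRatio_mem_Icc_on_window_of_dopingDisc_nonneg (Δ := ((147 : ℝ) / 100)) (a := ((117 : ℝ) / 100)) (b := ((73 : ℝ) / 100)) (c := ((657 : ℝ) / 3050))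
      (p := ((3231 : ℝ) / 2000)) (q := ((16977 : ℝ) / 10000)) (by norm_num) (by norm_num) (by norm_num) (by norm_num) (by norm_num) (by norm_num) (by norm_num)
      (by norm_num [dopingDisc]) hε).1
    refine le_trans ?_ hanti
    norm_num [fsRatio, fsD, fsN]
  · exact (fermiEnergyOf_pos (by norm_num) (by norm_num) (by norm_num) (by norm_num) (by norm_num) (by norm_num)).le
  · rw [hW]; exact hVhi.2
  · intro ε hε
    rw [hW]
    have hmono := (fsRatio_mem_Icc_on_window_of_dopingDisc_nonpos (Δ := ((56 : ℝ) / 25)) (a := ((69 : ℝ) / 50)) (b := ((61 : ℝ) / 100)) (c := ((427 : ℝ) / 3650))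
      (p := 0) (q := ((2237 : ℝ) / 1250)) (by norm_num) (by norm_num) (by norm_num) (by norm_num) (by norm_num) (by norm_num) (by norm_num)
      (by norm_num [dopingDisc]) hε).2
    refine le_trans hmono ?_
    norm_num [fsRatio, fsD, fsN]

/-- **n_H = 1.18 (ν = 41/100): for every row of the box the one-band Fermi-surface `t′/t` (object E, at the row's own Fermi energy) lies in `[-0.3411, -0.2501]`.** Lower closure: antitone; upper: monotone. [folklore] -/
theorem tl1223OPK11Box_fsRatio_nH118 {Δ a b c : ℝ} (hΔ : Δ ∈ Icc ((147 : ℝ) / 100) ((56 : ℝ) / 25)) (ha : a ∈ Icc ((117 : ℝ) / 100) ((69 : ℝ) / 50)) (hb : b ∈ Icc ((61 : ℝ) / 100) ((73 : ℝ) / 100)) (hc : c ∈ Icc ((7 : ℝ) / 50) ((9 : ℝ) / 50)) :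
    fsRatio Δ a b c (fermiEnergyOf Δ a b c ((41 : ℝ) / 100)) ∈ Icc ((-3411 : ℝ) / 10000) ((-2501 : ℝ) / 10000) := by
  have hV : ((9 : ℝ) / 50) * ((73 : ℝ) / 100) / ((61 : ℝ) / 100) = ((657 : ℝ) / 3050) := by norm_num
  have hW : ((7 : ℝ) / 50) * ((61 : ℝ) / 100) / ((73 : ℝ) / 100) = ((427 : ℝ) / 3650) := by norm_num
  have hVlo := (fermiEnergyOf_of_pointBracketCheck virtPt_Tl1223OPK11Vlo_nH118_br (by norm_num) (by norm_num) (by norm_num) (ν := (41/100 : ℝ)) (by push_cast; exact ⟨le_rfl, le_rfl⟩)).2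
  have hVhi := (fermiEnergyOf_of_pointBracketCheck virtPt_Tl1223OPK11Vhi_nH118_br (by norm_num) (by norm_num) (by norm_num) (ν := (41/100 : ℝ)) (by push_cast; exact ⟨le_rfl, le_rfl⟩)).2
  have hAlo := (fermiEnergyOf_of_pointBracketCheck virtPt_Tl1223OPK11Alo_nH118_br (by norm_num) (by norm_num) (by norm_num) (ν := (41/100 : ℝ)) (by push_cast; exact ⟨le_rfl, le_rfl⟩)).2
  have hTop := (fermiEnergyOf_of_pointBracketCheck virtPt_Tl1223OPK11H_nH118_br (by norm_num) (by norm_num) (by norm_num) (ν := (41/100 : ℝ)) (by push_cast; exact ⟨le_rfl, le_rfl⟩)).2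
  push_cast at hVlo hVhi hAlo hTop
  norm_num at hVlo hVhi hAlo hTop
  refine fsRatio_fermiEnergyOf_mem_Icc_windowClosure (Δ₁ := ((147 : ℝ) / 100)) (Δ₂ := ((56 : ℝ) / 25)) (a₁ := ((117 : ℝ) / 100)) (a₂ := ((69 : ℝ) / 50)) (b₁ := ((61 : ℝ) / 100))
    (b₂ := ((73 : ℝ) / 100)) (c₁ := ((7 : ℝ) / 50)) (c₂ := ((9 : ℝ) / 50)) (e₁ := ((7851 : ℝ) / 5000)) (e₂ := ((4131 : ℝ) / 2500)) (e₃ := 0) (e₄ := ((17531 : ℝ) / 10000)) (by norm_num) (by norm_num) (by norm_num) (by norm_num)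
    (by norm_num) hΔ ha hb hc (by norm_num) (by norm_num) ?_ ?_ ?_ (by norm_num) ?_ ?_ ?_ (by norm_num) ?_
  · -- regime at the box's Fermi-energy high corner: c₂ b₂ ε_F(Δ₁, a₂, b₂, c₁) ≤ a₁² b₁
    nlinarith [hTop.2]
  · rw [hV]; exact hVlo.1
  · exact hAlo.2
  · intro ε hε
    rw [hV]
    have hanti := (fsRatio_mem_Icc_on_window_of_dopingDisc_nonneg (Δ := ((147 : ℝ) / 100)) (a := ((117 : ℝ) / 100)) (b := ((73 : ℝ) / 100)) (c := ((657 : ℝ) / 3050))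
      (p := ((7851 : ℝ) / 5000)) (q := ((4131 : ℝ) / 2500)) (by norm_num) (by norm_num) (by norm_num) (by norm_num) (by norm_num) (by norm_num) (by norm_num)
      (by norm_num [dopingDisc]) hε).1
    refine le_trans ?_ hanti
    norm_num [fsRatio, fsD, fsN]
  · exact (fermiEnergyOf_pos (by norm_num) (by norm_num) (by norm_num) (by norm_num) (by norm_num) (by norm_num)).le
  · rw [hW]; exact hVhi.2
  · intro ε hε
    rw [hW]
    have hmono := (fsRatio_mem_Icc_on_window_of_dopingDisc_nonpos (Δ := ((56 : ℝ) / 25)) (a := ((69 : ℝ) / 50)) (b := ((61 : ℝ) / 100)) (c := ((427 : ℝ) / 3650))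
      (p := 0) (q := ((17531 : ℝ) / 10000)) (by norm_num) (by norm_num) (by norm_num) (by norm_num) (by norm_num) (by norm_num) (by norm_num)
      (by norm_num [dopingDisc]) hε).2
    refine le_trans hmono ?_
    norm_num [fsRatio, fsD, fsN]

end Summit.Ventures.CertifiedManyBodySolver.Downfold.Emery
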